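import Mathlib
import Literature.MathematicalPhysics.QuantumFieldTheory.Balaban1983to89.B4
import Literature.MathematicalPhysics.QuantumFieldTheory.Balaban1983to89.B5
import Literature.MathematicalPhysics.QuantumFieldTheory.Balaban1983to89.B9FromB6

/-!
# `Balaban1983to89.B5FromB4` — step S3 of B5's Proposition 1.2 imported from [2] = B4, entry by entry

B5 = T. Bałaban, *Propagators and renormalization transformations for lattice gauge theories. I*,
Commun. Math. Phys. **95**, 17–40 (1984) [Balaban1984PropagatorsI]; its reference [2] = B4 = T. Bałaban,
*Regularity and decay of lattice Green's functions*, Commun. Math. Phys. **89**, 571–597 (1983)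
[Balaban1983RegularityDecay].  Journal page of B5 = PDF page + 16.

CITATION HEADER (lean-in-tree rule 2026-08-18).  This module is a TYPED SKELETON of ONE printed passage, the step
"S3" of the proof of B5 Prop. 1.2 (pp. 39–40 [PDF 23–24]), which `B5.prop12_of_printed_steps` consumes as the bare
hypothesis `S3 : B5.Prop12Printed famG0`.  The passage, verbatim (p. 39): *"Properties of the operator G₀ can be
easily reduced to the corresponding properties of the operator G′ by the equality G₀ = G′ + G′(a_kQ′*Q′ − aQ*Q)G₀.
(1.133)  We only have to know some weak bounds for G₀, for example bounds in the L²-norm (1.89), or (1.114). This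
operator is given by the formula G₀J = Δ⁻¹J − aΔ⁻¹Q*φ⁻¹QΔ⁻¹J (1.134) for J orthogonal to constant functions, and
G₀J = a⁻¹J for J constant, hence by the first two terms in the representation (1.81). Thus its momentum
representation is given by (1.87) and we have Proposition 1.1 for G₀. This leads also to (1.114) by the same
reasoning with a random walk expansion as for G. In paper [2] we have proved all the necessary properties of G′,
except the second order inequalities (1.112), (1.113). Let us prove for example (1.112). We use Lemma 2.4 of that
paper and the equality (2.34) with □ replaced by the whole torus. … (1.135) … (1.136) and applying the estimates
(2.35)–(2.37) of Lemma 2.4 in [2] we obtain for x ∈ Δ̃(y), supp f ⊂ Δ̃(y′) … ≤ O(1)e^{−(1/2)δ′₀|y−y′|}(‖f‖_ε + |f|),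
(1.137) i.e., the inequality (1.112) with δ₀ = ½δ′₀. The proof of (1.113) is similar. Thus we have finished the proof
of Proposition 1.2."*  (Earlier, p. 35 [PDF 19]: *"Thus all the important operators we will work with in the future
are expressed in terms of the operators G_k and G′_k. The operators G′_k were investigated in paper [2]. In the next
section we will use those results and the methods of that paper to prove the corresponding properties of G_k."*)

WHAT IS KERNEL-CHECKED HERE (the audit's "second engine", elementary real arithmetic over the abstract carriers of
`B4.lean` / `B5.lean`): the EDGE
  `ThmDepPrinted` (B4 Theorem p. 573 at A = 0 on the torus) + DICTIONARY + MODEL SIGNS + RESIDUAL ENTRIES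
  ⟹ the first-order entries (1.110)–(1.111) of Prop. 1.2 for G′                        (`firstOrderGp_of_B4`),
the assembly of S3 exactly as the passage chains it                                       (`prop12G0_of_printed_steps`,
`prop12G0_of_B4`), and its insertion into b05's `B5.prop12_of_printed_steps`            (`prop12_of_B4`);
plus the two pieces of arithmetic the passage leaves to the reader: the conversion of B4's pointwise bounds
"c₀e^{−δ₀dist(x, supp f)}‖f‖_∞" into B5's cube-localized "O(1)e^{−δ₀|y−y′|}|J|" with O(1) = c₀e^{δ₀c} for x ∈ Δ̃(y),
supp J ⊂ Δ̃(y′), dist(x, supp J) ≥ |y − y′| − c (`exp_shift`, `pointwise_to_cube`), and the scale sum behind the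
ε-dependence of (1.137), Σ_{j=0}^{k−1}(L^jη)^ε ≤ 1/(L^ε − 1) for η = L^{−k} (`scale_sum_bound`: the printed "O(1) → ∞ if
ε → 0" of (1.112)).
WHAT REMAINS A NAMED HYPOTHESIS (= the located gaps of the cell census, GAPS C-B5-11 (S3), C-B5-17, G-B5-15):
* `ResidualGpFirst` — the entries of (1.110)–(1.111) for G′ that NO statement of [2] prints: the sup entries
  |(G′∇*J)(x)|, |(ΔG′J)(x)| and the Hölder entry ‖ζG′∇*J‖_α (B4's Theorem p. 573 prints (1.9)–(1.10) = the Hölder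
  quotient of D_μG f and the sups of D_μG f, G f only; at A = 0 the G′∇* entries follow from the symmetry of the
  kernel and the scale decomposition (1.135) + Lemma 2.4 exactly as (1.136) does for ∂G′∂*, and |ΔG′J| from
  ΔG′ = I − a_kQ′*Q′G′ — one line each, neither printed);
* `h137 : B4.Lemma24Printed … → SecondOrderFam famGp` — the displayed computation (1.135)–(1.137) and "the proof
  of (1.113) is similar" (its inputs are printed: B4 (2.34)–(2.37); its ε-mechanism is `scale_sum_bound`);
* `h11G0 : B5.Prop11Printed famG0` — "we have Proposition 1.1 for G₀" (same status as Prop. 1.1 itself, C-B5-4);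
* `h114G0` — "(1.114) [for G₀] by the same reasoning with a random walk expansion as for G" (cf. C-B5-16);
* `transfer` — "(1.133) … We only have to know some weak bounds for G₀" (the reduction G₀ ↝ G′, asserted).
TYPING REMARK (DIVERGENCE D-b05g2.1): B4's Theorem prints *"there exist positive constants δ₀, c₀, R₀ independent
of A, k, Ω and depending on d, M only, c₀ on α also"*; `B4.ThmPrinted` types the order ∀α ∃(δ₀, c₀, R₀, e₁), under
which δ₀ may shrink with α.  B5's (1.111) needs ONE δ₀ for all α < 1, i.e. the printed dependence; `ThmDepPrinted`
below is the same sentence with the quantifier order the print states (∃ δ₀ R₀ ∀ α ∃ c₀ e₁), and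
`thmPrinted_of_dep` records that it refines `B4.ThmPrinted`.  The charge e of B4 is irrelevant at A = 0 (U ≡ 1);
the dictionary therefore provides a B4 instance of every charge e > 0 (`ι`, `Dict.charge`), so that B4's
"for e sufficiently small" is met whatever the threshold.  B5 has NO background field at all (p. 17: *"We consider
the theory of one vector field with a quadratic action. Field configurations are real valued functions A defined
at bonds of the lattice T_ε"*), so every use of [2] in B5 is at A = 0 (GAPS C-B5-15, answering G-B4-07).

Value = typed skeleton + located gaps (the residual hypotheses ARE the gaps), NOT summit progress.
Cell pub-balaban, unit `b2b-balaban-b05-g2` (paper sub-cell B05, gen 2); census ids C-B5-11, C-B5-15, C-B5-16,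
C-B5-17, G-B5-15; companion prose `HOME/b2b-balaban-b05-g2/S3-census.md`.
-/

namespace Literature.MathematicalPhysics.QuantumFieldTheory.Balaban1983to89.B5FromB4

/-! ## The entry blocks of Prop. 1.2 (1.110)–(1.114) for ONE instance, separately -/

/-- The four sup entries (1.110), one at a time: n = 0, 1, 2, 3 ↔ |(GJ)(x)|, |(∇GJ)(x)|, |(G∇*J)(x)|, |(ΔGJ)(x)|
(sup over x ∈ Δ̃(y)), ≤ O(1)e^{−δ₀|y−y′|}|J| for supp J ⊂ Δ̃(y′). [cite: Balaban1984PropagatorsI, (1.110) p.35] -/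
def SupEntry (S : B5.Setting) (n : Fin 4) (C δ₀ : ℝ) : Prop :=
  ∀ (J : S.Loc) (y y' : S.Site), S.suppIn J y' →
    S.e n J y ≤ C * Real.exp (-(δ₀ * S.dist y y')) * S.supNorm J

/-- The Hölder entry (1.111): max(‖ζ∇GJ‖_α, ‖ζG∇*J‖_α) ≤ O(1)(α)e^{−δ₀|y−y′|}(‖ζ‖_α + |ζ|)|J|, 0 ≤ α < 1,
ζ ∈ C₀^∞(Δ̃(y)), supp J ⊂ Δ̃(y′). [cite: Balaban1984PropagatorsI, (1.111) p.35] -/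
def H1Entry (S : B5.Setting) (Cα : ℝ → ℝ) (δ₀ : ℝ) : Prop :=
  ∀ (α : ℝ) (J : S.Loc) (ζ : S.Cut) (y y' : S.Site), 0 ≤ α → α < 1 → S.cutIn ζ y → S.suppIn J y' →
    S.h1 J α ζ ≤ Cα α * Real.exp (-(δ₀ * S.dist y y')) * S.cutH α ζ * S.supNorm J

/-- The second-order sup entry (1.112): |(∇G∇*J)(x)| ≤ O(1)(ε)e^{−δ₀|y−y′|}(‖J‖_ε + |J|), 0 < ε < 1
("O(1) → ∞ if ε → 0"). [cite: Balaban1984PropagatorsI, (1.112) p.36] -/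
def E4Entry (S : B5.Setting) (Cε : ℝ → ℝ) (δ₀ : ℝ) : Prop :=
  ∀ (ε : ℝ) (J : S.Loc) (y y' : S.Site), 0 < ε → ε < 1 → S.suppIn J y' →
    S.e4 J y ≤ Cε ε * Real.exp (-(δ₀ * S.dist y y')) * (S.holder ε J + S.supNorm J)

/-- The second-order Hölder entry (1.113): ‖ζ∇G∇*J‖_α ≤ O(1)(α, ε)e^{−δ₀|y−y′|}(‖ζ‖_α + |ζ|)(‖J‖_{α+ε} + |J|),
0 ≤ α, 0 < ε, α + ε < 1. [cite: Balaban1984PropagatorsI, (1.113) p.36] -/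
def H2Entry (S : B5.Setting) (Cαε : ℝ → ℝ → ℝ) (δ₀ : ℝ) : Prop :=
  ∀ (α ε : ℝ) (J : S.Loc) (ζ : S.Cut) (y y' : S.Site), 0 ≤ α → 0 < ε → α + ε < 1 →
    S.cutIn ζ y → S.suppIn J y' →
    S.h2 J α ζ ≤ Cαε α ε * Real.exp (-(δ₀ * S.dist y y')) * S.cutH α ζ *
      (S.holder (α + ε) J + S.supNorm J)

/-- The six localized L² entries (1.114), one at a time (n = 0 … 5 ↔ ‖ζGJ‖, ‖ζ∇GJ‖, ‖ζG∇*J‖, ‖ζ∇G∇*J‖,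
‖ζ∇∇GJ‖, ‖ζG∇*∇*J‖). [cite: Balaban1984PropagatorsI, (1.114) p.36] -/
def L2Entry (S : B5.Setting) (n : Fin 6) (C δ₀ : ℝ) : Prop :=
  ∀ (J : S.Loc) (ζ : S.Cut) (y y' : S.Site), S.cutIn ζ y → S.suppIn J y' →
    S.l2loc n J ζ ≤ C * Real.exp (-(δ₀ * S.dist y y')) * S.cutSup ζ * S.l2Norm J

/-- Bookkeeping: r1's block `B5.Ineq110_114` is literally the conjunction of the entry blocks. [folklore] -/
theorem ineq110_114_iff (S : B5.Setting) (C : ℝ) (Cα Cε : ℝ → ℝ) (Cαε : ℝ → ℝ → ℝ) (δ₀ : ℝ) :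
    B5.Ineq110_114 S C Cα Cε Cαε δ₀ ↔
      (∀ n, SupEntry S n C δ₀) ∧ H1Entry S Cα δ₀ ∧ E4Entry S Cε δ₀ ∧ H2Entry S Cαε δ₀ ∧
        ∀ n, L2Entry S n C δ₀ :=
  Iff.rfl

/-- Bookkeeping: the four sup entries separately give the sup block. [folklore] -/
theorem supEntry_all {S : B5.Setting} {C δ₀ : ℝ} (h0 : SupEntry S 0 C δ₀) (h1 : SupEntry S 1 C δ₀)
    (h2 : SupEntry S 2 C δ₀) (h3 : SupEntry S 3 C δ₀) : ∀ n, SupEntry S n C δ₀ := by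
  intro n
  fin_cases n
  exacts [h0, h1, h2, h3]

/-! ## Family blocks (constants chosen before the instance i = (k, T_η)) -/

variable {I : Type}

/-- The first-order entries (1.110)–(1.111) of Prop. 1.2 for a family, with the printed quantifier order
(δ₀, O(1), O(1)(α) before the instance). [cite: Balaban1984PropagatorsI, (1.110)–(1.111) p.35] -/
def FirstOrderFam (fam : I → B5.Setting) : Prop :=
  ∃ δ₀ C : ℝ, ∃ Cα : ℝ → ℝ, 0 < δ₀ ∧ 0 < C ∧ ∀ i : I,
    (∀ n, SupEntry (fam i) n C δ₀) ∧ H1Entry (fam i) Cα δ₀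

/-- The second-order entries (1.112)–(1.113) of Prop. 1.2 for a family. [cite: Balaban1984PropagatorsI, (1.112)–(1.113) p.36] -/
def SecondOrderFam (fam : I → B5.Setting) : Prop :=
  ∃ δ₀ : ℝ, ∃ Cε : ℝ → ℝ, ∃ Cαε : ℝ → ℝ → ℝ, 0 < δ₀ ∧ ∀ i : I,
    E4Entry (fam i) Cε δ₀ ∧ H2Entry (fam i) Cαε δ₀

/-- Bookkeeping: `B5.Local114Fam` (b05) is the family form of the L² entries. [folklore] -/
theorem local114Fam_iff (fam : I → B5.Setting) :
    B5.Local114Fam fam ↔ ∃ δ₀ C : ℝ, 0 < δ₀ ∧ 0 < C ∧ ∀ i : I, ∀ n, L2Entry (fam i) n C δ₀ :=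
  Iff.rfl

/-- Sign facts of the norms and distances of B5 Sect. F ((1.108)–(1.109) p. 35: |J|, ‖J‖_α, ‖ζ‖_α + |ζ|, |ζ| are
sups of absolute values / of non-negative quotients; ‖J‖ is an L² norm; |y − y′| ≥ 0), evident in the model and
invisible to the abstract carrier `B5.Setting`; recorded as explicit hypotheses of the edge theorems (they are what
allows merging decay rates by `min` and constants by `max`, the arithmetic of "with different constants O(1)"). [folklore] -/
structure ModelSigns (S : B5.Setting) : Prop where
  dist_nonneg : ∀ y y' : S.Site, 0 ≤ S.dist y y'
  supNorm_nonneg : ∀ J : S.Loc, 0 ≤ S.supNorm J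
  l2Norm_nonneg : ∀ J : S.Loc, 0 ≤ S.l2Norm J
  holder_nonneg : ∀ (ε : ℝ) (J : S.Loc), 0 ≤ S.holder ε J
  cutH_nonneg : ∀ (α : ℝ) (ζ : S.Cut), 0 ≤ S.cutH α ζ
  cutSup_nonneg : ∀ ζ : S.Cut, 0 ≤ S.cutSup ζ

/-! ## Weakening of constants and decay rates; the two pieces of arithmetic left to the reader -/

/-- Weakening for a bound of the shape q ≤ c·e^{−δt}·p·m (p, m ≥ 0), B5's order of factors; the three-factor
form `weaken3` and `decay_mono` are the landed ones of `B9FromB6` (reused, not restated). [folklore] -/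
theorem weaken4 {q c c' δ δ' t p m : ℝ} (h : q ≤ c * Real.exp (-(δ * t)) * p * m) (hc : c ≤ c')
    (hc' : 0 ≤ c') (hp : 0 ≤ p) (hm : 0 ≤ m) (hδ : δ' ≤ δ) (ht : 0 ≤ t) :
    q ≤ c' * Real.exp (-(δ' * t)) * p * m := by
  have h' : q ≤ c * Real.exp (-(δ * t)) * (p * m) := by simpa [mul_assoc] using h
  have := B9FromB6.weaken3 h' hc hc' (mul_nonneg hp hm) hδ ht
  simpa [mul_assoc] using this

/-- The exponential arithmetic of the B4 → B5 conversion: if dist(x, supp f) ≥ |y − y′| − c then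
e^{−δ₀dist(x, supp f)} ≤ e^{δ₀c}·e^{−δ₀|y−y′|} (δ₀ ≥ 0). [folklore] -/
theorem exp_shift {δ s t c : ℝ} (hδ : 0 ≤ δ) (h : t - c ≤ s) :
    Real.exp (-(δ * s)) ≤ Real.exp (δ * c) * Real.exp (-(δ * t)) := by
  rw [← Real.exp_add]
  apply Real.exp_le_exp.mpr
  have := mul_le_mul_of_nonneg_left h hδ
  nlinarith

/-- **Pointwise-to-cube conversion.**  A B4-type bound v ≤ c₀e^{−δ₀s}m₄ at a point x with s = dist(x, supp f)
≥ |y − y′| − c and m₄ = ‖f‖_∞ ≤ m = |J| gives the B5-type bound v ≤ (c₀e^{δ₀c})e^{−δ₀|y−y′|}|J|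
(c₀, δ₀, m ≥ 0).  This is the whole content of "for x ∈ Δ̃(y), supp J ⊂ Δ̃(y′)" (B5 (1.110)) versus
"dist(x, supp f)" (B4 (1.10)): Δ̃(y), Δ̃(y′) are cubes of size 2 centred at y, y′ (p. 35), so c = c(d). [folklore] -/
theorem pointwise_to_cube {v c₀ δ₀ s t c m₄ m : ℝ} (hv : v ≤ c₀ * Real.exp (-(δ₀ * s)) * m₄)
    (hc₀ : 0 ≤ c₀) (hδ : 0 ≤ δ₀) (hs : t - c ≤ s) (hm₄ : m₄ ≤ m) (hm : 0 ≤ m) :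
    v ≤ c₀ * Real.exp (δ₀ * c) * Real.exp (-(δ₀ * t)) * m := by
  have h1 : c₀ * Real.exp (-(δ₀ * s)) * m₄ ≤ c₀ * Real.exp (-(δ₀ * s)) * m :=
    mul_le_mul_of_nonneg_left hm₄ (mul_nonneg hc₀ (Real.exp_nonneg _))
  have h2 : c₀ * Real.exp (-(δ₀ * s)) * m ≤ c₀ * (Real.exp (δ₀ * c) * Real.exp (-(δ₀ * t))) * m :=
    mul_le_mul_of_nonneg_right (mul_le_mul_of_nonneg_left (exp_shift hδ hs) hc₀) hm
  calc v ≤ c₀ * Real.exp (-(δ₀ * s)) * m₄ := hv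
    _ ≤ c₀ * Real.exp (-(δ₀ * s)) * m := h1
    _ ≤ c₀ * (Real.exp (δ₀ * c) * Real.exp (-(δ₀ * t))) * m := h2
    _ = c₀ * Real.exp (δ₀ * c) * Real.exp (-(δ₀ * t)) * m := by ring

/-- **The ε-mechanism of (1.137).**  With η = L^{−k} the scale factors of (1.136) sum as
Σ_{j=0}^{k−1}(L^jη)^ε = Σ_{m=1}^{k} L^{−mε} ≤ L^{−ε}/(1 − L^{−ε}) = 1/(L^ε − 1), uniformly in k, for L > 1, ε > 0 —
finite for every ε > 0 and → ∞ as ε → 0: the printed "constant O(1) depending on d and ε (O(1) → ∞ if ε → 0)"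
of (1.112).  (Real powers; L^jη = L^{j−k}.) [cite: Balaban1984PropagatorsI, (1.136)–(1.137) p.40] -/
theorem scale_sum_bound (L ε : ℝ) (hL : 1 < L) (hε : 0 < ε) (k : ℕ) :
    ∑ j ∈ Finset.range k, (L ^ ((j : ℝ) - k)) ^ ε ≤ 1 / (L ^ ε - 1) := by
  have hL0 : 0 < L := lt_trans zero_lt_one hL
  obtain ⟨r, hr⟩ : ∃ r : ℝ, r = L ^ (-ε) := ⟨_, rfl⟩
  have hr0 : 0 < r := by rw [hr]; exact Real.rpow_pos_of_pos hL0 _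
  have hr1 : r < 1 := by rw [hr]; exact Real.rpow_lt_one_of_one_lt_of_neg hL (neg_lt_zero.mpr hε)
  have hr0' : r ≠ 0 := hr0.ne'
  have h1r : 0 < 1 - r := sub_pos.mpr hr1
  have h1r' : 1 - r ≠ 0 := h1r.ne'
  have hLε : L ^ ε = r⁻¹ := by rw [hr, Real.rpow_neg hL0.le, inv_inv]
  have hterm : ∀ j ∈ Finset.range k, (L ^ ((j : ℝ) - k)) ^ ε = r * r ^ (k - 1 - j) := by
    intro j hj
    have hjk : j < k := Finset.mem_range.mp hj
    have hexp : ((j : ℝ) - k) * ε = -ε * (((k - 1 - j : ℕ) : ℝ) + 1) := by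
      rw [Nat.cast_sub (show j ≤ k - 1 by omega), Nat.cast_sub (show 1 ≤ k by omega)]
      push_cast
      ring
    rw [← Real.rpow_mul hL0.le, hexp, Real.rpow_mul hL0.le, ← hr, Real.rpow_add hr0,
      Real.rpow_natCast, Real.rpow_one, mul_comm]
  have hgeom : ∑ m ∈ Finset.range k, r ^ m ≤ 1 / (1 - r) := by
    have h := geom_sum_Ico_le_of_lt_one hr0.le hr1 (m := 0) (n := k)
    rw [pow_zero, ← Finset.range_eq_Ico] at h
    exact h
  calc ∑ j ∈ Finset.range k, (L ^ ((j : ℝ) - k)) ^ ε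
      = ∑ j ∈ Finset.range k, r * r ^ (k - 1 - j) := Finset.sum_congr rfl hterm
    _ = r * ∑ j ∈ Finset.range k, r ^ j := by
        rw [← Finset.mul_sum, Finset.sum_range_reflect (fun m => r ^ m) k]
    _ ≤ r * (1 / (1 - r)) := mul_le_mul_of_nonneg_left hgeom hr0.le
    _ = 1 / (L ^ ε - 1) := by
        rw [hLε]
        field_simp

/-! ## Prop. 1.2 from / to its entry blocks -/

/-- Prop. 1.2 (as typed by r1, one constant set for all five blocks) yields the three family blocks. [folklore] -/
theorem blocks_of_prop12 (fam : I → B5.Setting) (h : B5.Prop12Printed fam) :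
    FirstOrderFam fam ∧ SecondOrderFam fam ∧ B5.Local114Fam fam := by
  obtain ⟨δ₀, C, Cα, Cε, Cαε, hδ, hC, H⟩ := h
  refine ⟨⟨δ₀, C, Cα, hδ, hC, fun i => ⟨(H i).1, (H i).2.1⟩⟩,
    ⟨δ₀, Cε, Cαε, hδ, fun i => ⟨(H i).2.2.1, (H i).2.2.2.1⟩⟩,
    ⟨δ₀, C, hδ, hC, fun i => (H i).2.2.2.2⟩⟩

/-- Conversely the three family blocks (each with its own rate and constants) merge into Prop. 1.2 as typed:
δ₀ = min of the rates, O(1) = max of the constants (and max{·, 0} for the α-, ε-dependent ones), using the model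
signs. [folklore] -/
theorem prop12_of_blocks (fam : I → B5.Setting) (Sg : ∀ i, ModelSigns (fam i)) (h1 : FirstOrderFam fam)
    (h2 : SecondOrderFam fam) (h3 : B5.Local114Fam fam) : B5.Prop12Printed fam := by
  obtain ⟨δ₁, C₁, Cα, hδ₁, hC₁, H1⟩ := h1
  obtain ⟨δ₂, Cε, Cαε, hδ₂, H2⟩ := h2
  obtain ⟨δ₃, C₃, hδ₃, hC₃, H3⟩ := h3
  obtain ⟨δ₀, hδ₀, hd1, hd2, hd3⟩ : ∃ δ₀ : ℝ, 0 < δ₀ ∧ δ₀ ≤ δ₁ ∧ δ₀ ≤ δ₂ ∧ δ₀ ≤ δ₃ :=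
    ⟨min δ₁ (min δ₂ δ₃), lt_min hδ₁ (lt_min hδ₂ hδ₃), min_le_left _ _,
      (min_le_right _ _).trans (min_le_left _ _), (min_le_right _ _).trans (min_le_right _ _)⟩
  obtain ⟨C, hC, hc1, hc3⟩ : ∃ C : ℝ, 0 < C ∧ C₁ ≤ C ∧ C₃ ≤ C :=
    ⟨max C₁ C₃, lt_max_of_lt_left hC₁, le_max_left _ _, le_max_right _ _⟩
  refine ⟨δ₀, C, fun α => max (Cα α) 0, fun ε => max (Cε ε) 0, fun α ε => max (Cαε α ε) 0, hδ₀, hC, ?_⟩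
  intro i
  have Sgi := Sg i
  obtain ⟨He, Hh1⟩ := H1 i
  obtain ⟨He4, Hh2⟩ := H2 i
  have Hl2 := H3 i
  refine (ineq110_114_iff (fam i) C _ _ _ δ₀).mpr ⟨?_, ?_, ?_, ?_, ?_⟩
  · intro n J y y' hs
    exact B9FromB6.weaken3 (He n J y y' hs) hc1 hC.le (Sgi.supNorm_nonneg J) hd1 (Sgi.dist_nonneg y y')
  · intro α J ζ y y' hα0 hα1 hζ hs
    exact weaken4 (Hh1 α J ζ y y' hα0 hα1 hζ hs) (le_max_left _ _) (le_max_right _ _)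
      (Sgi.cutH_nonneg α ζ) (Sgi.supNorm_nonneg J) hd1 (Sgi.dist_nonneg y y')
  · intro ε J y y' hε0 hε1 hs
    exact B9FromB6.weaken3 (He4 ε J y y' hε0 hε1 hs) (le_max_left _ _) (le_max_right _ _)
      (add_nonneg (Sgi.holder_nonneg ε J) (Sgi.supNorm_nonneg J)) hd2 (Sgi.dist_nonneg y y')
  · intro α ε J ζ y y' hα0 hε0 hαε hζ hs
    exact weaken4 (Hh2 α ε J ζ y y' hα0 hε0 hαε hζ hs) (le_max_left _ _) (le_max_right _ _)
      (Sgi.cutH_nonneg α ζ) (add_nonneg (Sgi.holder_nonneg _ J) (Sgi.supNorm_nonneg J)) hd2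
      (Sgi.dist_nonneg y y')
  · intro n J ζ y y' hζ hs
    exact weaken4 (Hl2 n J ζ y y' hζ hs) hc3 hC.le (Sgi.cutSup_nonneg ζ) (Sgi.l2Norm_nonneg J) hd3
      (Sgi.dist_nonneg y y')

/-! ## B4's Theorem p. 573 with the printed dependence of its constants -/

variable {I₄ : Type}

/-- **B4 Theorem p. 573 [PDF 3], the printed constant dependence made explicit** (verbatim: *"For α < 1 there exist
positive constants δ₀, c₀, R₀ independent of A, k, Ω and depending on d, M only, c₀ on α also, such that for e
sufficiently small … (1.9) … (1.10) … (1.11) … (1.12)"*): δ₀ and R₀ are chosen BEFORE α, c₀ and the smallness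
threshold e₁ after it.  `B4.ThmPrinted` (b04) types the coarser order ∀α ∃(δ₀, c₀, R₀, e₁); B5 (1.111) consumes
the printed one (one δ₀ for every Hölder exponent α).  DIVERGENCE D-b05g2.1. [cite: Balaban1983RegularityDecay, Theorem (1.9)–(1.12) p.573] -/
def ThmDepPrinted (fam : I₄ → B4.EtaSetting) : Prop :=
  ∃ δ₀ R₀ : ℝ, 0 < δ₀ ∧ 0 < R₀ ∧ ∀ α : ℝ, α < 1 → ∃ c₀ e₁ : ℝ, 0 < c₀ ∧ 0 < e₁ ∧ ∀ i : I₄,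
    (fam i).regular → (fam i).bigBlocks → 0 < (fam i).e → (fam i).e ≤ e₁ →
      B4.Ineq19_110 (fam i) α δ₀ c₀ R₀ ∧ B4.Ineq111_112 (fam i) α δ₀ c₀ R₀

/-- The printed dependence refines b04's typing. [folklore] -/
theorem thmPrinted_of_dep (fam : I₄ → B4.EtaSetting) (h : ThmDepPrinted fam) : B4.ThmPrinted fam := by
  obtain ⟨δ₀, R₀, hδ, hR, H⟩ := h
  intro α hα
  obtain ⟨c₀, e₁, hc, he, H'⟩ := H α hα
  exact ⟨δ₀, c₀, R₀, e₁, hδ, hc, hR, he, H'⟩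

/-! ## The dictionary B5 ↔ B4 at A = 0 and the residual entries for G′ -/

/-- The two Hölder functionals that `B5.Setting.h1` maximizes, kept apart for G′: `hD J α ζ` = ‖ζ∇G′J‖_α,
`hS J α ζ` = ‖ζG′∇*J‖_α, h1 = max of the two (an inequality suffices).  B4 prints a statement for the first only
((1.9)–(1.10)); the second is residual. [cite: Balaban1984PropagatorsI, (1.111) p.35] -/
structure GpHolder (S : B5.Setting) where
  hD : S.Loc → ℝ → S.Cut → ℝ
  hS : S.Loc → ℝ → S.Cut → ℝ
  h1_le : ∀ (J : S.Loc) (α : ℝ) (ζ : S.Cut), S.h1 J α ζ ≤ max (hD J α ζ) (hS J α ζ)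

/-- **The dictionary at A = 0** between ONE B4 instance S₄ and the B5 instance S of the quantities of G′ = G′_k in
the vocabulary of Prop. 1.2.  THE IDENTIFICATION (B5 p. 35: *"The operators G′_k were investigated in paper [2]"*;
p. 39: *"the equality (2.34) with □ replaced by the whole torus"*): G′_k = (Δ + a_kQ′*_kQ′_k)^{−1} of B5 Sect. B
acting componentwise on vector fields J, each component being [2]'s G_k(Ω, A) (1.6) with Ω = Ω₀ = the whole torus
T_η, A = 0 (U ≡ 1, N = 1; `regular` (1.7) holds trivially), m² = 0, a = a_k ([2] itself writes a_k in its Sect. 2),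
charge `e` (irrelevant at A = 0); `c` = the geometric constant of the cube conversion.  What the structure ASSERTS
(GAPS G-B5-15 — none of it is spelled out in B5): the B4 hypotheses of the Theorem for this instance (`regular`,
`bigBlocks` — a torus T_η of every size occurring in B5 must be admissible as Ω = "a union of big blocks" of [2] —,
`rect` — the torus counts among the "simple sets Ω, e.g. rectangular parallelepipeds" for which (1.9)–(1.10) hold
"without any restrictions on the points x, x′", B4 p. 573); `dir` — a lattice direction (d ≥ 1; `B4.Ineq19_110`
quantifies the direction outside the pair (|D_μGf|, |Gf|) of (1.10)); `loc J` = J read as a B4 source f with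
‖f‖_∞ ≤ |J| (`supNorm_le`); `inCube x y` = "x within distance 1 of Δ̃(y)" and `inPair x x′ y` = "x, x′ within
distance 1 of Δ̃(y), |x − x′| ≤ 1", with the geometric facts dist(x, supp J) ≥ |y − y′| − c and
dist({x, x′}, supp J) ≥ |y − y′| − c for supp J ⊂ Δ̃(y′) (`geom1`, `geom2`; Δ̃(y) = a cube of size 2 centred at y,
p. 35); the sup entries n = 0, 1 of (1.110) are sups over Δ̃(y) of B4's pointwise values |(Gf)(x)|, |(D_μGf)(x)|
(`e0_le`, `e1_le`); and the product rule for the cut-off Hölder norm (1.109) (sup over |x − x′| ≤ 1; only pairs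
meeting supp ζ ⊂ Δ̃(y) contribute): ‖ζg‖_α ≤ |ζ|·sup_pairs |x−x′|^{−α}|g(x)−g(x′)| + ‖ζ‖_α·sup|g| ≤
(‖ζ‖_α + |ζ|)(b₁ + b₂) for g = ∇G′J (`hD_le`).  All fields are identities / trivialities of the lattice model,
invisible to the abstract carriers. [cite: Balaban1984PropagatorsI, p.35 and p.39] -/
structure Dict (S₄ : B4.EtaSetting) (S : B5.Setting) (F : GpHolder S) (c e : ℝ) where
  charge : S₄.e = e
  regular : S₄.regular
  bigBlocks : S₄.bigBlocks
  rect : S₄.rect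
  dir : S₄.Dir
  loc : S.Loc → S₄.Src
  inCube : S₄.Site → S.Site → Prop
  inPair : S₄.Site → S₄.Site → S.Site → Prop
  geom1 : ∀ (x : S₄.Site) (y : S.Site) (J : S.Loc) (y' : S.Site), inCube x y → S.suppIn J y' →
    S.dist y y' - c ≤ S₄.sdist1 x (loc J)
  geom2 : ∀ (x x' : S₄.Site) (y : S.Site) (J : S.Loc) (y' : S.Site), inPair x x' y → S.suppIn J y' →
    S.dist y y' - c ≤ S₄.sdist2 x x' (loc J)
  supNorm_le : ∀ J : S.Loc, S₄.supNorm (loc J) ≤ S.supNorm J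
  e0_le : ∀ (J : S.Loc) (y : S.Site) (b : ℝ), (∀ x, inCube x y → S₄.valG (loc J) x ≤ b) → S.e 0 J y ≤ b
  e1_le : ∀ (J : S.Loc) (y : S.Site) (b : ℝ), (∀ μ x, inCube x y → S₄.valDG μ (loc J) x ≤ b) → S.e 1 J y ≤ b
  hD_le : ∀ (J : S.Loc) (α : ℝ) (ζ : S.Cut) (y : S.Site) (b₁ b₂ : ℝ), S.cutIn ζ y → 0 ≤ b₁ → 0 ≤ b₂ →
    (∀ μ x x', inPair x x' y → S₄.lhs19 α μ (loc J) x x' ≤ b₁) →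
    (∀ μ x, inCube x y → S₄.valDG μ (loc J) x ≤ b₂) → F.hD J α ζ ≤ S.cutH α ζ * (b₁ + b₂)

/-- **Residual first-order entries of G′** — the part of *"In paper [2] we have proved all the necessary properties
of G′, except the second order inequalities"* (p. 39) with NO printed counterpart in [2]: the sup entries
|(G′∇*J)(x)|, |(ΔG′J)(x)| of (1.110) and the Hölder entry ‖ζG′∇*J‖_α of (1.111), uniformly over the family.
(B4's Theorem p. 573 is about D_μG f and G f; its Corollary 2.3 gives ⟨f, GD*f′⟩ in L² only.  At A = 0:
(G′∇*J)(x) = Σ_{x′}η^d(∇_{x′}G′(x, x′))·J(x′) by the symmetry of the kernel, bounded through (1.135) and Lemma 2.4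
(2.35) exactly as in (1.136); ΔG′J = J − a_kQ′*Q′G′J.  Neither line is printed — GAPS C-B5-17.) [cite: Balaban1984PropagatorsI, p.39] -/
def ResidualGpFirst (famGp : I → B5.Setting) (F : ∀ i, GpHolder (famGp i)) : Prop :=
  ∃ δ₀ C : ℝ, ∃ Cα : ℝ → ℝ, 0 < δ₀ ∧ 0 < C ∧ ∀ i : I,
    SupEntry (famGp i) 2 C δ₀ ∧ SupEntry (famGp i) 3 C δ₀ ∧
    (∀ (α : ℝ) (J : (famGp i).Loc) (ζ : (famGp i).Cut) (y y' : (famGp i).Site), 0 ≤ α → α < 1 →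
      (famGp i).cutIn ζ y → (famGp i).suppIn J y' →
      (F i).hS J α ζ ≤ Cα α * Real.exp (-(δ₀ * (famGp i).dist y y')) * (famGp i).cutH α ζ *
        (famGp i).supNorm J)

/-! ## The edge theorem: the first-order entries of G′ from B4's Theorem -/

/-- **(1.110)–(1.111) for G′ from [2], kernel-checked.**  From B4's Theorem (printed dependence) at A = 0 on the
torus: (1.10) gives the sup entries |(G′J)(x)|, |(∇G′J)(x)| with O(1) = c₀(0)e^{δ₀c} (α = 0 is used for them),
(1.9) + (1.10) + the product rule give ‖ζ∇G′J‖_α with O(1)(α) = 2c₀(α)e^{δ₀c}; the entries |(G′∇*J)(x)|,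
|(ΔG′J)(x)|, ‖ζG′∇*J‖_α are the residual hypothesis; rates merged by min, constants by max.  The charge: for each
α the B4 threshold e₁(α) is met by the dictionary's instance of charge e₁(α) (A = 0: every charge gives the same
operator). [cite: Balaban1984PropagatorsI, p.39 "In paper [2] we have proved all the necessary properties of G′"] -/
theorem firstOrderGp_of_B4 (fam₄ : I₄ → B4.EtaSetting) (famGp : I → B5.Setting)
    (F : ∀ i, GpHolder (famGp i)) (c : ℝ) (ι : I → ℝ → I₄)
    (D : ∀ (i : I) (e : ℝ), 0 < e → Dict (fam₄ (ι i e)) (famGp i) (F i) c e)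
    (Sg : ∀ i, ModelSigns (famGp i))
    (hThm : ThmDepPrinted fam₄) (hRes : ResidualGpFirst famGp F) : FirstOrderFam famGp := by
  obtain ⟨δ₄, R₀, hδ₄, hR₀, H⟩ := hThm
  choose c₀ e₁ Hc using H
  obtain ⟨δr, Cr, Cαr, hδr, hCr, Hr⟩ := hRes
  have h01 : (0 : ℝ) < 1 := zero_lt_one
  -- B4 at exponent α for the member i, through the dictionary's instance of charge e₁(α)
  have B4at : ∀ (α : ℝ) (hα : α < 1) (i : I),
      B4.Ineq19_110 (fam₄ (ι i (e₁ α hα))) α δ₄ (c₀ α hα) R₀ := by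
    intro α hα i
    obtain ⟨hc0, he1, HP⟩ := Hc α hα
    have Di := D i (e₁ α hα) he1
    exact (HP (ι i (e₁ α hα)) Di.regular Di.bigBlocks (lt_of_lt_of_eq he1 Di.charge.symm)
      (le_of_eq Di.charge)).1
  have hc00 : 0 < c₀ 0 h01 := (Hc 0 h01).1
  -- merged constants
  obtain ⟨δ₀, hδ₀, hd4, hdr⟩ : ∃ δ₀ : ℝ, 0 < δ₀ ∧ δ₀ ≤ δ₄ ∧ δ₀ ≤ δr :=
    ⟨min δ₄ δr, lt_min hδ₄ hδr, min_le_left _ _, min_le_right _ _⟩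
  obtain ⟨C, hC, hC4, hCr'⟩ : ∃ C : ℝ, 0 < C ∧ c₀ 0 h01 * Real.exp (δ₄ * c) ≤ C ∧ Cr ≤ C :=
    ⟨max (c₀ 0 h01 * Real.exp (δ₄ * c)) Cr, lt_max_of_lt_right hCr, le_max_left _ _, le_max_right _ _⟩
  refine ⟨δ₀, C, fun α => if hα : α < 1 then max (max (2 * c₀ α hα * Real.exp (δ₄ * c)) (Cαr α)) 0 else 0,
    hδ₀, hC, fun i => ⟨?_, ?_⟩⟩
  · -- the four sup entries: n = 0, 1 from B4 (1.10) at α = 0; n = 2, 3 residual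
    have Sgi := Sg i
    obtain ⟨Hr2, Hr3, -⟩ := Hr i
    have Di := D i (e₁ 0 h01) (Hc 0 h01).2.1
    have B0 := B4at 0 h01 i
    refine supEntry_all ?_ ?_ ?_ ?_
    · intro J y y' hs
      have key : (famGp i).e 0 J y ≤ c₀ 0 h01 * Real.exp (δ₄ * c) *
          Real.exp (-(δ₄ * (famGp i).dist y y')) * (famGp i).supNorm J :=
        Di.e0_le J y _ fun x hx =>
          pointwise_to_cube (B0.2 Di.dir (Di.loc J) x (Or.inl Di.rect)).2 hc00.le hδ₄.le
            (Di.geom1 x y J y' hx hs) (Di.supNorm_le J) (Sgi.supNorm_nonneg J)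
      exact B9FromB6.weaken3 key hC4 hC.le (Sgi.supNorm_nonneg J) hd4 (Sgi.dist_nonneg y y')
    · intro J y y' hs
      have key : (famGp i).e 1 J y ≤ c₀ 0 h01 * Real.exp (δ₄ * c) *
          Real.exp (-(δ₄ * (famGp i).dist y y')) * (famGp i).supNorm J :=
        Di.e1_le J y _ fun μ x hx =>
          pointwise_to_cube (B0.2 μ (Di.loc J) x (Or.inl Di.rect)).1 hc00.le hδ₄.le
            (Di.geom1 x y J y' hx hs) (Di.supNorm_le J) (Sgi.supNorm_nonneg J)
      exact B9FromB6.weaken3 key hC4 hC.le (Sgi.supNorm_nonneg J) hd4 (Sgi.dist_nonneg y y')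
    · intro J y y' hs
      exact B9FromB6.weaken3 (Hr2 J y y' hs) hCr' hC.le (Sgi.supNorm_nonneg J) hdr (Sgi.dist_nonneg y y')
    · intro J y y' hs
      exact B9FromB6.weaken3 (Hr3 J y y' hs) hCr' hC.le (Sgi.supNorm_nonneg J) hdr (Sgi.dist_nonneg y y')
  · -- the Hölder entry (1.111): the ∇G′ half ⇐ (1.9), (1.10), product rule; the G′∇* half residual
    have Sgi := Sg i
    obtain ⟨-, -, HrS⟩ := Hr i
    intro α J ζ y y' hα0 hα1 hζ hs
    obtain ⟨hcα, heα, -⟩ := Hc α hα1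
    have Di := D i (e₁ α hα1) heα
    have B := B4at α hα1 i
    have hb0 : 0 ≤ c₀ α hα1 * Real.exp (δ₄ * c) * Real.exp (-(δ₄ * (famGp i).dist y y')) *
        (famGp i).supNorm J :=
      mul_nonneg (mul_nonneg (mul_nonneg hcα.le (Real.exp_nonneg _)) (Real.exp_nonneg _))
        (Sgi.supNorm_nonneg J)
    have hD : (F i).hD J α ζ ≤ (famGp i).cutH α ζ *
        (c₀ α hα1 * Real.exp (δ₄ * c) * Real.exp (-(δ₄ * (famGp i).dist y y')) * (famGp i).supNorm J +
          c₀ α hα1 * Real.exp (δ₄ * c) * Real.exp (-(δ₄ * (famGp i).dist y y')) * (famGp i).supNorm J) := by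
      refine Di.hD_le J α ζ y _ _ hζ hb0 hb0 ?_ ?_
      · intro μ x x' hxx
        exact pointwise_to_cube (B.1 μ (Di.loc J) x x' (Or.inl Di.rect)) hcα.le hδ₄.le
          (Di.geom2 x x' y J y' hxx hs) (Di.supNorm_le J) (Sgi.supNorm_nonneg J)
      · intro μ x hx
        exact pointwise_to_cube (B.2 μ (Di.loc J) x (Or.inl Di.rect)).1 hcα.le hδ₄.le
          (Di.geom1 x y J y' hx hs) (Di.supNorm_le J) (Sgi.supNorm_nonneg J)
    have hD' : (F i).hD J α ζ ≤ 2 * c₀ α hα1 * Real.exp (δ₄ * c) *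
        Real.exp (-(δ₄ * (famGp i).dist y y')) * (famGp i).cutH α ζ * (famGp i).supNorm J := by
      refine hD.trans (le_of_eq ?_)
      ring
    have hCα : (if hα : α < 1 then max (max (2 * c₀ α hα * Real.exp (δ₄ * c)) (Cαr α)) 0 else 0) =
        max (max (2 * c₀ α hα1 * Real.exp (δ₄ * c)) (Cαr α)) 0 := dif_pos hα1
    dsimp only
    rw [hCα]
    have hCα0 : 0 ≤ max (max (2 * c₀ α hα1 * Real.exp (δ₄ * c)) (Cαr α)) 0 := le_max_right _ _
    have hD'' := weaken4 hD'
      ((le_max_left _ _).trans (le_max_left _ _) :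
        2 * c₀ α hα1 * Real.exp (δ₄ * c) ≤ max (max (2 * c₀ α hα1 * Real.exp (δ₄ * c)) (Cαr α)) 0)
      hCα0 (Sgi.cutH_nonneg α ζ) (Sgi.supNorm_nonneg J) hd4 (Sgi.dist_nonneg y y')
    have hS'' := weaken4 (HrS α J ζ y y' hα0 hα1 hζ hs)
      ((le_max_right _ _).trans (le_max_left _ _) :
        Cαr α ≤ max (max (2 * c₀ α hα1 * Real.exp (δ₄ * c)) (Cαr α)) 0)
      hCα0 (Sgi.cutH_nonneg α ζ) (Sgi.supNorm_nonneg J) hdr (Sgi.dist_nonneg y y')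
    exact ((F i).h1_le J α ζ).trans (max_le hD'' hS'')

/-! ## S3 assembled as printed, and its insertion into `B5.prop12_of_printed_steps` -/

/-- **S3 (pp. 39–40) ⇐ its printed steps**, chained exactly as the passage chains them (each step a hypothesis
shaped as the printed sentence): Prop. 1.1 for G₀ ("momentum representation (1.87)"), hence (1.114) for G₀ ("by the
same reasoning with a random walk expansion as for G"); the first- and second-order localized entries for G′
("In paper [2] … except the second order inequalities", "(1.135)–(1.137) … The proof of (1.113) is similar");
the transfer G′ ↝ G₀ by (1.133) ("easily reduced … We only have to know some weak bounds for G₀"); merged into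
Prop. 1.2 for G₀ by `prop12_of_blocks`. [cite: Balaban1984PropagatorsI, pp.39–40] -/
theorem prop12G0_of_printed_steps (famGp famG0 : I → B5.Setting) (SgG0 : ∀ i, ModelSigns (famG0 i))
    (h11G0 : B5.Prop11Printed famG0)
    (h114G0 : B5.Prop11Printed famG0 → B5.Local114Fam famG0)
    (hGp1 : FirstOrderFam famGp) (hGp2 : SecondOrderFam famGp)
    (transfer : FirstOrderFam famGp → SecondOrderFam famGp → B5.Local114Fam famG0 →
      FirstOrderFam famG0 ∧ SecondOrderFam famG0) :
    B5.Prop12Printed famG0 := by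
  have h114 := h114G0 h11G0
  obtain ⟨h1, h2⟩ := transfer hGp1 hGp2 h114
  exact prop12_of_blocks famG0 SgG0 h1 h2 h114

/-- **S3 from [2] = B4, the edge composed**: B4's Theorem (printed dependence) through the dictionary gives the
printed half of the first-order entries of G′ (`firstOrderGp_of_B4`), B4's Lemma 2.4 feeds the displayed
computation (1.135)–(1.137) (`h137`), and the passage's remaining sentences are the named hypotheses. [cite: Balaban1984PropagatorsI, pp.39–40] -/
theorem prop12G0_of_B4 {I₂₄ : Type} (fam₄ : I₄ → B4.EtaSetting) (fam₂₄ : I₂₄ → B4.ScaleSetting)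
    (famGp famG0 : I → B5.Setting) (F : ∀ i, GpHolder (famGp i)) (c : ℝ) (ι : I → ℝ → I₄)
    (D : ∀ (i : I) (e : ℝ), 0 < e → Dict (fam₄ (ι i e)) (famGp i) (F i) c e)
    (SgGp : ∀ i, ModelSigns (famGp i)) (SgG0 : ∀ i, ModelSigns (famG0 i))
    (hThm : ThmDepPrinted fam₄) (h24 : B4.Lemma24Printed fam₂₄)
    (hRes : ResidualGpFirst famGp F)
    (h137 : B4.Lemma24Printed fam₂₄ → SecondOrderFam famGp)
    (h11G0 : B5.Prop11Printed famG0)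
    (h114G0 : B5.Prop11Printed famG0 → B5.Local114Fam famG0)
    (transfer : FirstOrderFam famGp → SecondOrderFam famGp → B5.Local114Fam famG0 →
      FirstOrderFam famG0 ∧ SecondOrderFam famG0) :
    B5.Prop12Printed famG0 :=
  prop12G0_of_printed_steps famGp famG0 SgG0 h11G0 h114G0
    (firstOrderGp_of_B4 fam₄ famGp F c ι D SgGp hThm hRes) (h137 h24) transfer

/-- **Prop. 1.2 with its [2]-import explicit**: b05's `B5.prop12_of_printed_steps` with the hypothesis
`S3 : B5.Prop12Printed famG0` discharged by `prop12G0_of_B4`; every other step keeps the shape it has there. [cite: Balaban1984PropagatorsI, pp.36–40] -/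
theorem prop12_of_B4 {I₂₄ : Type} (fam₄ : I₄ → B4.EtaSetting) (fam₂₄ : I₂₄ → B4.ScaleSetting)
    (fam famGp famG0 : I → B5.Setting) (g : ∀ i, B5.GlobalH (fam i)) (K : I → B5.KernelData)
    (F : ∀ i, GpHolder (famGp i)) (c : ℝ) (ι : I → ℝ → I₄)
    (D : ∀ (i : I) (e : ℝ), 0 < e → Dict (fam₄ (ι i e)) (famGp i) (F i) c e)
    (SgGp : ∀ i, ModelSigns (famGp i)) (SgG0 : ∀ i, ModelSigns (famG0 i))
    (hThm : ThmDepPrinted fam₄) (h24 : B4.Lemma24Printed fam₂₄)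
    (hRes : ResidualGpFirst famGp F)
    (h137 : B4.Lemma24Printed fam₂₄ → SecondOrderFam famGp)
    (h11G0 : B5.Prop11Printed famG0)
    (h114G0 : B5.Prop11Printed famG0 → B5.Local114Fam famG0)
    (transfer : FirstOrderFam famGp → SecondOrderFam famGp → B5.Local114Fam famG0 →
      FirstOrderFam famG0 ∧ SecondOrderFam famG0)
    (h11 : B5.Prop11Printed fam) (hleaf : B5.Kernel126_127Printed K)
    (S1' : B5.Prop11Printed fam → B5.Kernel126_127Printed K → B5.Local114Fam fam)
    (S2 : B5.Prop12Printed famG0 → B5.Kernel126_127Printed K → B5.Local114Fam fam →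
      B5.Global115_117Fam fam g)
    (S1 : B5.Global115_117Fam fam g → B5.Prop11Printed fam → B5.Kernel126_127Printed K →
      B5.Prop12Printed fam) :
    B5.Prop12Printed fam :=
  B5.prop12_of_printed_steps fam famG0 g K h11 hleaf S1'
    (prop12G0_of_B4 fam₄ fam₂₄ famGp famG0 F c ι D SgGp SgG0 hThm h24 hRes h137 h11G0 h114G0 transfer)
    S2 S1

end Literature.MathematicalPhysics.QuantumFieldTheory.Balaban1983to89.B5FromB4
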